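import Summits.BirchSwinnertonDyer.BirchSwinnertonDyer.Theorems.SignedLowerHalvesKobayashiMainConjectureSmallImageLambdaTransferCM
import Summits.BirchSwinnertonDyer.BirchSwinnertonDyer.Theorems.SignedLowerHalvesKobayashiLowerHalfLargeImageCongruencePlaces
import Summits.BirchSwinnertonDyer.BirchSwinnertonDyer.Theorems.SignedLowerHalvesKobayashiLowerHalfLargeImageCongruencePlacesGood
import Summits.BirchSwinnertonDyer.BirchSwinnertonDyer.Theorems.SignedLowerHalvesKobayashiMainConjectureSmallImageCMTransferMuRecords02
import Summits.BirchSwinnertonDyer.BirchSwinnertonDyer.Theorems.SignedLowerHalvesKobayashiMainConjectureSmallImageCMTransferRecordsA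
import Literature.NumberTheory.EllipticCurves.Fisher2012.HesseFamilyFiveClosedForms
import HarnessLib

/-!
# Route `SignedLowerHalves`, crux `KobayashiMainConjectureSmallImage` (item stmt-BirchSwinnertonDyer-19002):
# small-image congruence road («L4-λ») — RECORDS «L4LAM-r2» part C: 301824bp1 @ 5 (cell `bsd-ssimc`, seat `bsd-ssimc-k3-c4` gen 8; planner D26-6 (a)(ii);
# a `--supports stmt-BirchSwinnertonDyer-19002 --as helper` file; closes nothing about the crux)

PARTITION (cell bsd-ssimc): X7 (A7) × the pair `301824bp1 @ 5` — per-pair records (Kobayashi's signed main conjecture for the listed signs and `BSD(E,5)`, from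
PUBLISHED facts + displayed certificates); the crux `KobayashiMainConjectureSmallImage` stays OPEN; 0 census moves are booked here (desk
keys are the planner's to file); BSD is not proved by any of this. THEOREMS ONLY.

## Provenance (finding «CM-25» of the seat's MEMO-8)

These pairs were booked «no CM elliptic-curve partner» by the seat's gen-0 probe (`cm_congruence_probe.tsv`), which at `p = 3` searched
only the `j = 1728` family; the quadratic field of the normaliser character is in fact a class-number-one field with `p` inert, and the CM
curve of that field (or a quadratic twist) IS `p`-congruent to `E` — here PROVED in the kernel by a Fisher Hesse-pencil identity (`norm_num`;
certificates found by g5's exact `cert/hesse3_find.py` at `p = 3`, by g0's `hesse.gp` (PARI, kit j268836) at `p = 5`). The records then run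
verbatim on g6's road (`…LambdaTransferCM.lean` p473173; template `…LambdaTransferCMRecords01.lean` p474509):
`SmallImageCongruenceRoad.kobayashiMainConjecture_{neg_one,one}_of_cmPartner_of_mazurTate` — partner MC = Pollack–Rubin 2004 BY NAME (`hPR`;
`p` inert in the CM field, checked per pair), Kim 2009 μ- and λ-transfer BY NAME (`h09`, `hKim`), Kobayashi Thm. 1.2 / 4.1-rational (`h12`,
`h41`), period units (`h5`, `h3`), modularity (`hmod`), Pollack (`hPollack`), Fisher n = 5 (`hF`); per pair the DISPLAYED certificate rows (two engines
agreeing: B = b2b msengine `MSENGINE_SHA256SUMS`, T = iw-2 `engT.py` d8b96ce8, byte-identical re-uses, kit j268836; E-side rows also b2b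
`b2b-bsdres-iw-2/tables/engT_layers.tsv` CERTIFIED+AGREE where marked) as `(hΘ, hΘ0, hμ, hlam)` quadruples, and the KERNEL-DECIDED δ-bookkeeping
(`places_<tag>`, toolkit `…LargeImageCongruencePlaces(.Good).lean` p467415). NO `Surj`, NO `BSD(E,p)` input, NO preprint, NO Mazur–Tate
congruence `hMT`.

This part: the OPEN desk cell `301824bp1 @ 5` (X7, `r_an = 0`; `residue [(5,'X7')]` on 1edf686acdce8117), sign ε = −1 (the odd layer is
the one certified on both sides), with its `BSDp W 5` corollary through the IMAGE-FREE rank-0 road. The n = 5 congruence rests on the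
named fact `hF : thm132_fiveCongruent_hessePencil` (Fisher 2012, PUBLISHED; priced flag-free at desk R461), as in the landed 484416do1 record.

References: [Kobayashi2003] Conj. (p. 2), Thm. 1.2, 4.1; [BDKim2009] Cor. 2.13, 2.5, Prop. 2.6; [PollackRubin2004] Thm. (p. 448);
[Pollack2003] Def. 6.15, Prop. 6.9/6.10/6.18; [Fisher2012Hessian] Thm. 13.2, §13; [GreenbergVatsal2000] Prop. (2.4); [BDKim2013] Cor. 3.15;
[Cremona2006] Table 1; [SilvermanAEC2009] V §2, VII.5, App. C §11. Memo: `HOME/k3c4-MEMO-8.md`.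
-/

set_option autoImplicit false
set_option linter.dupNamespace false
noncomputable section

open scoped Classical MatrixGroups ModularForm BigOperators

open CongruenceSubgroup WeierstrassCurve NumberField IsDedekindDomain Rat.HeightOneSpectrum
  Literature.NumberTheory.EllipticCurves
  Literature.NumberTheory.EllipticCurves.ModularForms
  Literature.NumberTheory.EllipticCurves.Rank1Residual
  Literature.NumberTheory.EllipticCurves.Rank1Residual.Typed
  Literature.NumberTheory.EllipticCurves.Kobayashi2003 ZpExtension
  Literature.NumberTheory.EllipticCurves.GreenbergVatsal2000
  Literature.NumberTheory.EllipticCurves.BDKim2009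
  Literature.NumberTheory.EllipticCurves.Fisher2012
  Literature.NumberTheory.EllipticCurves.Rank1Residual.X11RankOneCertificates
  Literature.NumberTheory.GaloisRepresentations
  Summit.BirchSwinnertonDyer.Rank1Residual.X1.MuLambda
  Summit.BirchSwinnertonDyer.Rank1Residual.Supersingular
  Summit.BirchSwinnertonDyer.Rank1Residual.X2.LocalDeltaCalculus
  Summit.BirchSwinnertonDyer.BirchSwinnertonDyer.Rank1Residual.IntModel
  Summit.BirchSwinnertonDyer.BirchSwinnertonDyer.Rank1Residual.X11RankOne
  Summit.BirchSwinnertonDyer.Rank1Residual.X11b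
  Summit.BirchSwinnertonDyer.Rank1Residual.X9
  Summit.BirchSwinnertonDyer.Rank1Residual.X1
  Summit.BirchSwinnertonDyer.BirchSwinnertonDyer.Theorems.CongruenceRoad

namespace Summit.BirchSwinnertonDyer.BirchSwinnertonDyer.Theorems.SmallImageCongruenceRoad


/-! ### §1 Kernel data of the pair -/

/-- `#{Ẽ(𝔽_5)} = 6` for the Cremona model of `301824bp1` = `[0, 0, 0, -519960, 151523264]` (`a_5 = 0`; kernel count). [cite: SilvermanAEC2009, V §2 (a_p = p + 1 − #Ẽ(𝔽_p))] -/
theorem card_lam25_301824bp1_5 :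
    Nat.card (((⟨0, 0, 0, -519960, 151523264⟩ : WeierstrassCurve ℤ).map
      (Int.castRingHom (ZMod 5))).toAffine.Point) = 6 := by
  rw [@WeierstrassCurve.natCard_point_eq_one_add_card (ZMod 5) (@ZMod.instField 5 ⟨by norm_num⟩) _ _ _
    (by decide +kernel), @card_sol_eq_sum_euler (ZMod 5) (@ZMod.instField 5 ⟨by norm_num⟩) _ _
    (by rw [ZMod.ringChar_zmod_n]; decide), ZMod.card]
  decide +kernel
/-- `#{Ẽ(𝔽_5)} = 6` for the CM partner `cmm8_tw1_p5` = `[0, 0, 0, -30, 56]` (`a_5 = 0`; kernel count). [cite: SilvermanAEC2009, V §2 (a_p = p + 1 − #Ẽ(𝔽_p))] -/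
theorem card_lam25_A2304_5 :
    Nat.card (((⟨0, 0, 0, -30, 56⟩ : WeierstrassCurve ℤ).map
      (Int.castRingHom (ZMod 5))).toAffine.Point) = 6 := by
  rw [@WeierstrassCurve.natCard_point_eq_one_add_card (ZMod 5) (@ZMod.instField 5 ⟨by norm_num⟩) _ _ _
    (by decide +kernel), @card_sol_eq_sum_euler (ZMod 5) (@ZMod.instField 5 ⟨by norm_num⟩) _ _
    (by rw [ZMod.ringChar_zmod_n]; decide), ZMod.card]
  decide +kernel
/-- The CM partner `[0, 0, 0, -30, 56]` has CM (`j = 8000 ∈` the thirteen rational CM values; kernel). [cite: SilvermanAEC2009, App. C §11] -/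
theorem hasCM_lam25_A2304 {A : WeierstrassCurve ℚ} [A.IsElliptic] [A.IsGloballyMinimal]
    (hIA : integralModelInt A = ⟨0, 0, 0, -30, 56⟩) : A.HasCM :=
  (hasCM_iff_j_mem_holds A).mpr (by rw [j_eq_of_intModel 0 0 0 (-30) 56 hIA]; decide +kernel)

/-- `#(𝔽_131)`-point count `150` of `[0, 0, 0, -30, 56]` (the CM partner A of the pair `301824bp1 @ 5`; fast count, kernel). [cite: SilvermanAEC2009, V §2] -/
theorem countPoints_301824bp1_5_A_131 : countPoints [0, 0, 0, -30, 56] 131 = (150 : ℕ) :=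
  countPoints_eq_of_fast (by decide +kernel)

/-- **The δ-bookkeeping of `(301824bp1, A = cmm8_tw1_p5)` at `5`, KERNEL-DECIDED**: with `Σ₀` the places over `{2, 3, 131}` (away from
`5`, containing every bad place of both curves), `Σ_{Σ₀} δ_E = 1` and `Σ_{Σ₀} δ_A = 2` (ℓ = 2: E additive; ℓ = 2: A additive; ℓ = 3: E additive; ℓ = 3: A additive; ℓ = 131: E split; ℓ = 131: A good_dvd).
[cite: GreenbergVatsal2000, §2 Prop. (2.4) (p. 22)] [cite: SilvermanAEC2009, VII.5 Prop. 5.1] -/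
theorem places_301824bp1_5 (W A : WeierstrassCurve ℚ) [W.IsElliptic] [W.IsGloballyMinimal]
    [A.IsElliptic] [A.IsGloballyMinimal]
    (hW : W = ⟨0, 0, 0, -519960, 151523264⟩) (hA : A = ⟨0, 0, 0, -30, 56⟩) :
    ∃ S₀ : Finset (HeightOneSpectrum (𝓞 ℚ)), (∀ v ∈ S₀, ((5 : ℕ) : 𝓞 ℚ) ∉ v.asIdeal) ∧
      (∀ v : HeightOneSpectrum (𝓞 ℚ), ¬ W.HasGoodReductionAt v → v ∈ S₀) ∧
      (∀ v : HeightOneSpectrum (𝓞 ℚ), ¬ A.HasGoodReductionAt v → v ∈ S₀) ∧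
      ∑ v ∈ S₀, delta W 5 v = 1 ∧ ∑ v ∈ S₀, delta A 5 v = 2 := by
  have hI : integralModelInt W = ⟨0, 0, 0, -519960, 151523264⟩ :=
    integralModelInt_eq_of_map_eq _ (by rw [hW]; ext <;> simp [WeierstrassCurve.map])
  have hI' : integralModelInt A = ⟨0, 0, 0, -30, 56⟩ :=
    integralModelInt_eq_of_map_eq _ (by rw [hA]; ext <;> simp [WeierstrassCurve.map])
  set v2 : HeightOneSpectrum (𝓞 ℚ) := (primesEquiv (R := 𝓞 ℚ)).symm ⟨2, Nat.prime_two⟩ with hv2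
  set v3 : HeightOneSpectrum (𝓞 ℚ) := (primesEquiv (R := 𝓞 ℚ)).symm ⟨3, by norm_num⟩ with hv3
  set v131 : HeightOneSpectrum (𝓞 ℚ) := (primesEquiv (R := 𝓞 ℚ)).symm ⟨131, by norm_num⟩ with hv131
  have d2 : delta W 5 v2 = 0 :=
    delta_eq_zero_of_dvd_of_dvd hI 5 v2 (by rw [hv2, natGenerator_symm]; decide)
      (by rw [hv2, natGenerator_symm]; decide)
  have d3 : delta W 5 v3 = 0 :=
    delta_eq_zero_of_dvd_of_dvd hI 5 v3 (by rw [hv3, natGenerator_symm]; decide)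
      (by rw [hv3, natGenerator_symm]; decide)
  have d131 : delta W 5 v131 = 1 := by
    rw [delta_eq_of_split hI 5 v131 131 (by norm_num) (by rw [hv131, natGenerator_symm]) (by decide) (by decide)
      ⟨45, by decide +kernel⟩, sFactor_eq_of_eq_pow_mul (k := 0) (m := 58899984) (by norm_num) (by norm_num)]
    decide
  have e2 : delta A 5 v2 = 0 :=
    delta_eq_zero_of_dvd_of_dvd hI' 5 v2 (by rw [hv2, natGenerator_symm]; decide)
      (by rw [hv2, natGenerator_symm]; decide)
  have e3 : delta A 5 v3 = 0 :=
    delta_eq_zero_of_dvd_of_dvd hI' 5 v3 (by rw [hv3, natGenerator_symm]; decide)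
      (by rw [hv3, natGenerator_symm]; decide)
  have e131 : delta A 5 v131 = 2 := by
    rw [delta_eq_of_good_of_dvd_count hI' 5 v131 131 (by norm_num) (by rw [hv131, natGenerator_symm]) (by norm_num)
      (by norm_num) rfl (by decide) countPoints_301824bp1_5_A_131 (by decide),
      sFactor_eq_of_eq_pow_mul (k := 0) (m := 58899984) (by norm_num) (by norm_num)]
    decide
  have n1 : v2 ∉ ({v3, v131} : Finset (HeightOneSpectrum (𝓞 ℚ))) := by
    simp only [Finset.mem_insert, Finset.mem_singleton, hv2, hv3, hv131, not_or]
    exact ⟨symm_ne_symm _ _ (by norm_num), symm_ne_symm _ _ (by norm_num)⟩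
  have n2 : v3 ∉ ({v131} : Finset (HeightOneSpectrum (𝓞 ℚ))) := by
    simp only [Finset.mem_singleton, hv3, hv131]
    exact symm_ne_symm _ _ (by norm_num)
  refine ⟨{v2, v3, v131}, ?_, ?_, ?_, ?_, ?_⟩
  · intro v hv
    simp only [Finset.mem_insert, Finset.mem_singleton] at hv
    rcases hv with rfl | rfl | rfl
    · exact natCast_not_mem_symm (by norm_num) _ (by norm_num)
    · exact natCast_not_mem_symm (by norm_num) _ (by norm_num)
    · exact natCast_not_mem_symm (by norm_num) _ (by norm_num)
  · -- `Σ₀ ⊇` bad places of `E`: `Δ(E) = -(2 ^ 15 * 3 ^ 6 * 131 ^ 5)`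
    intro v hv
    by_contra hvS
    apply hv
    apply hasGoodReductionAt_of_not_dvd hI
    intro hdvd
    have hΔ : (⟨0, 0, 0, -519960, 151523264⟩ : WeierstrassCurve ℤ).Δ = -(2 ^ 15 * 3 ^ 6 * 131 ^ 5) := by
      decide
    rw [hΔ, dvd_neg] at hdvd
    have hpr := prime_natGenerator v
    have h' : natGenerator v ∣ 2 ^ 15 * 3 ^ 6 * 131 ^ 5 := by exact_mod_cast hdvd
    have key : natGenerator v = 2 ∨ natGenerator v = 3 ∨ natGenerator v = 131 := by
      rcases (Nat.Prime.dvd_mul hpr).mp h' with h | h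
      · rcases (Nat.Prime.dvd_mul hpr).mp h with h | h
        · exact Or.inl ((Nat.prime_dvd_prime_iff_eq hpr Nat.prime_two).mp (hpr.dvd_of_dvd_pow h))
        · exact Or.inr (Or.inl ((Nat.prime_dvd_prime_iff_eq hpr (by norm_num)).mp (hpr.dvd_of_dvd_pow h)))
      · exact Or.inr (Or.inr ((Nat.prime_dvd_prime_iff_eq hpr (by norm_num)).mp (hpr.dvd_of_dvd_pow h)))
    apply hvS
    simp only [Finset.mem_insert, Finset.mem_singleton]
    rcases key with h | h | h
    · exact Or.inl (eq_symm_of_natGenerator_eq Nat.prime_two h)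
    · exact Or.inr (Or.inl (eq_symm_of_natGenerator_eq (by norm_num) h))
    · exact Or.inr (Or.inr (eq_symm_of_natGenerator_eq (by norm_num) h))
  · -- `Σ₀ ⊇` bad places of `A`: `Δ(A) = 2 ^ 9 * 3 ^ 6`
    intro v hv
    by_contra hvS
    apply hv
    apply hasGoodReductionAt_of_not_dvd hI'
    intro hdvd
    have hΔ : (⟨0, 0, 0, -30, 56⟩ : WeierstrassCurve ℤ).Δ = 2 ^ 9 * 3 ^ 6 := by
      decide
    rw [hΔ] at hdvd
    have hpr := prime_natGenerator v
    have h' : natGenerator v ∣ 2 ^ 9 * 3 ^ 6 := by exact_mod_cast hdvd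
    have key : natGenerator v = 2 ∨ natGenerator v = 3 := by
      rcases (Nat.Prime.dvd_mul hpr).mp h' with h | h
      · exact Or.inl ((Nat.prime_dvd_prime_iff_eq hpr Nat.prime_two).mp (hpr.dvd_of_dvd_pow h))
      · exact Or.inr ((Nat.prime_dvd_prime_iff_eq hpr (by norm_num)).mp (hpr.dvd_of_dvd_pow h))
    apply hvS
    simp only [Finset.mem_insert, Finset.mem_singleton]
    rcases key with h | h
    · exact Or.inl (eq_symm_of_natGenerator_eq Nat.prime_two h)
    · exact Or.inr (Or.inl (eq_symm_of_natGenerator_eq (by norm_num) h))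
  · norm_num [Finset.sum_insert n1, Finset.sum_insert n2, Finset.sum_singleton, d2, d3, d131]
  · norm_num [Finset.sum_insert n1, Finset.sum_insert n2, Finset.sum_singleton, e2, e3, e131]

/-! ### §2 The records -/

/-- **`lam4_301824bp1_5` — Kobayashi's main conjecture for `(301824bp1, 5, ε)` (sign ε = -1), AT THE PAIR by the small-image
congruence road with the CM partner `A = cmm8_tw1_p5` = `[0, 0, 0, -30, 56]` ([0,0,0,-30,56] (conductor 2304, CM by an order of ℚ(√−2), j = 8000; `5` inert; r_an = 1)) — NO preprint, NO `Surj`, NO `BSD(E,5)` input, NO Mazur–Tate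
congruence `hMT`.** Desk cell (referee A's live state `scratchA_A_state_after_addord3_fold.pkl` sha16 1edf686acdce8117): `residue; [(5,'X7')]` (OPEN). Certificates DISPLAYED as
hypotheses (kit j268836, engines byte-identical re-uses: B = b2b msengine `MSENGINE_SHA256SUMS`, T = iw-2 `engT.py` d8b96ce8, A = PARI `ellpadiclambdamu` via
`engineA.py` a8b8e893; E-side rows also b2b `tables/engT_layers.tsv` where marked): ε = -1: E row θ_1 (λ = deg ω_1^+ + 2), A row θ_1 (λ = deg + 1). E row = b2b `b2b-bsdres-iw-2/tables/engT_layers.tsv` 301824bp1@5 layer 1 (odd, ε = −1): λ(θ₁) = 2 = deg ω₁⁺ + 2, engine T CERTIFIED (V = 2) and engine B AGREE (quoted, not re-run; the even layer-2 row is not certified there, so only ε = −1 is recorded); partner row (kit j268836, key `cmm8_tw1_p5`): θ₁: λ = 1 = deg ω₁⁺ + 1 — engine T CERTIFIED V = 1 (exact `msfromell` match), engine B (μ, λ) = (0, 1), engine A `ellpadiclambdamu` = [[1, 1], [0, 0]]. The `5`-congruence is KERNEL-CHECKED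
(`E` ≅ the member (48 : 1) of Fisher's pencil X_A(5) of the MINIMAL partner model, u = 241864704, `fiveCongruent_of_hesseCertificate` under the named fact `hF` (Fisher 2012 Thm 13.2, n = 5); certificate found by g0's `hesse.gp` on the short model (kit j268836 `cm/hesse_certificates.tsv`), transported to the minimal model and re-verified exactly by the seat's `fisher5.py`); the δ-bookkeeping `l_E + 1 = l_A + 2` is `places_301824bp1_5` (kernel); `a_5 = 0` for both curves and the CM of `A` are
decided in the kernel. Published inputs BY NAME (`h12 h41 h5 h3 h09 hKim hPR hmod hPollack` hF). PER PAIR; crux 4 stays OPEN; nothing booked;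
BSD is not proved by any of this.
[cite: Kobayashi2003, Conjecture (p. 2), Thm. 1.2 and Thm. 4.1] [cite: BDKim2009, Cor. 2.13, Cor. 2.5 and Prop. 2.6 (pp. 185–187)]
[cite: PollackRubin2004, Theorem (p. 448) = Thm. 7.3] [cite: Pollack2003, Def. 6.15, Prop. 6.9, 6.10 and 6.18]
[cite: Fisher2012Hessian, Thm. 13.2 and §13] [cite: GreenbergVatsal2000, §2 Prop. (2.4)] [cite: Cremona2006, Table 1 (Cremona label 301824bp1)] -/
theorem lam4_kobayashiMainConjecture_301824bp1_5
    (h12 : Kobayashi2003.thm12_signedSelmerDual_finite_torsion)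
    (h41 : Kobayashi2003.thm41_signedCharIdeal_divisibility)
    (h5 : realPeriodRat_eq_unit_mul_plusPeriod) (h3 : realPeriodRat_eq_unit_mul_plusPeriod_three)
    (h09 : cor213_signedMu_eq_zero_iff_of_torsionIso)
    (hKim : BDKim2009.cor213_signedLambda_add_sum_delta_eq_of_torsionIso)
    (hPR : PollackRubin2004.mainTheorem_signedCharIdeal_eq_of_cm)
    (hmod : nonempty_modularParametrizationData)
    (hF : thm132_fiveCongruent_hessePencil)
    (W A : WeierstrassCurve ℚ) [W.IsElliptic] [W.IsGloballyMinimal] [A.IsElliptic] [A.IsGloballyMinimal]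
    [Fact (Nat.Prime 5)] (hW : W = ⟨0, 0, 0, -519960, 151523264⟩) (hA : A = ⟨0, 0, 0, -30, 56⟩)
    (hPollack : ∀ {N : ℕ} [NeZero N] {f : CuspForm (Gamma0 N) 2},
      pollack_exists_plusMinusPAdicLFunction (W := A) (f := f) (p := 5))
    [NeZero (W.conductorNorm ℤ)] {f₀ : CuspForm (Gamma0 (W.conductorNorm ℤ)) 2} (hf₀ : IsNewformOf W f₀)
    [NeZero (A.conductorNorm ℤ)] {f₀' : CuspForm (Gamma0 (A.conductorNorm ℤ)) 2} (hf₀' : IsNewformOf A f₀')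
    (ε : ℤˣ) {Θ Θ' : IwasawaAlgebra 5} (hΘ0 : Θ ≠ 0) (hμ : mu Θ = 0) (hΘ'0 : Θ' ≠ 0) (hμ' : mu Θ' = 0)
    (hrow : ε = -1 ∧
        iwasawaToPowerSeries 5 Θ = ((mazurTateElement f₀ 5 1).map (algebraMap ℚ ℚ_[5]) : PowerSeries ℚ_[5]) ∧
        lam Θ = (cyclotomicOmegaPlus 5 1).natDegree + 2 ∧
        iwasawaToPowerSeries 5 Θ' = ((mazurTateElement f₀' 5 1).map (algebraMap ℚ ℚ_[5]) : PowerSeries ℚ_[5]) ∧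
        lam Θ' = (cyclotomicOmegaPlus 5 1).natDegree + 1) :
    KobayashiMainConjecture W 5 ε := by
  have hI : integralModelInt W = ⟨0, 0, 0, -519960, 151523264⟩ :=
    integralModelInt_eq_of_map_eq _ (by rw [hW]; ext <;> simp [WeierstrassCurve.map])
  have hI' : integralModelInt A = ⟨0, 0, 0, -30, 56⟩ :=
    integralModelInt_eq_of_map_eq _ (by rw [hA]; ext <;> simp [WeierstrassCurve.map])
  have hp2 : (5 : ℕ) ≠ 2 := by decide
  have hSS : GoodSS W 5 := goodSS_of_intModel 5 hI (by decide) card_lam25_301824bp1_5 (by norm_num)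
  have hap : W.frobeniusTrace 5 = 0 := by rw [frobeniusTrace_eq hI card_lam25_301824bp1_5]; norm_num
  have hSS' : GoodSS A 5 := goodSS_of_intModel 5 hI' (by decide) card_lam25_A2304_5 (by norm_num)
  have hap' : A.frobeniusTrace 5 = 0 := by rw [frobeniusTrace_eq hI' card_lam25_A2304_5]; norm_num
  have hcm' : A.HasCM := hasCM_lam25_A2304 hI'
  have hc4 : W.c₄ = (24958080 : ℚ) := by
    subst hW; norm_num [WeierstrassCurve.c₄, WeierstrassCurve.b₂, WeierstrassCurve.b₄]
  have hc6 : W.c₆ = (-130916100096 : ℚ) := by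
    subst hW; norm_num [WeierstrassCurve.c₆, WeierstrassCurve.b₂, WeierstrassCurve.b₄, WeierstrassCurve.b₆]
  have hc4A : A.c₄ = (1440 : ℚ) := by
    subst hA; norm_num [WeierstrassCurve.c₄, WeierstrassCurve.b₂, WeierstrassCurve.b₄]
  have hc6A : A.c₆ = (-48384 : ℚ) := by
    subst hA; norm_num [WeierstrassCurve.c₆, WeierstrassCurve.b₂, WeierstrassCurve.b₄, WeierstrassCurve.b₆]
  -- the 5-congruence `E[5] ≃ A[5]` as a THEOREM (Fisher's pencil of `A` through `E`), kernel-checked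
  have he := fiveCongruent_of_hesseCertificate hF A W (48 : ℚ) (1 : ℚ) (241864704 : ℚ)
    (by norm_num) (by rw [hc4A, hc6A, hc4, eval_hesseC4]; norm_num)
    (by rw [hc4A, hc6A, hc6, eval_hesseC6]; norm_num)
  obtain ⟨S₀, hS₀, hS₀W, hS₀A, hsumW, hsumA⟩ := places_301824bp1_5 W A hW hA
  obtain ⟨rfl, hΘ, hlam, hΘ', hlam'⟩ := hrow
  exact kobayashiMainConjecture_neg_one_of_cmPartner_of_mazurTate h12 h41 h5 h3 h09 hKim hPR hmod hp2 hSS.1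
      hap hf₀ (by decide) hΘ hΘ0 hμ hlam hPollack hcm' hSS' hap' he hf₀' (by decide) hΘ' hΘ'0 hμ' hlam' S₀
      hS₀ hS₀W hS₀A (by rw [hsumW, hsumA])

/-- **Item 4's statement AT THE PAIR `301824bp1 @ 5`**: `∃ ε, KobayashiMainConjecture W 5 ε`, from `lam4_kobayashiMainConjecture_301824bp1_5` with
the `ε = -1` rows. PER PAIR; the crux is untouched; nothing booked. [cite: Kobayashi2003, Conjecture (p. 2) and Thm. 4.1] [cite: BDKim2009, Cor. 2.13 (p. 187)]
[cite: Cremona2006, Table 1 (Cremona label 301824bp1)] -/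
theorem lam4_exists_kobayashiMainConjecture_301824bp1_5
    (h12 : Kobayashi2003.thm12_signedSelmerDual_finite_torsion)
    (h41 : Kobayashi2003.thm41_signedCharIdeal_divisibility)
    (h5 : realPeriodRat_eq_unit_mul_plusPeriod) (h3 : realPeriodRat_eq_unit_mul_plusPeriod_three)
    (h09 : cor213_signedMu_eq_zero_iff_of_torsionIso)
    (hKim : BDKim2009.cor213_signedLambda_add_sum_delta_eq_of_torsionIso)
    (hPR : PollackRubin2004.mainTheorem_signedCharIdeal_eq_of_cm)
    (hmod : nonempty_modularParametrizationData)
    (hF : thm132_fiveCongruent_hessePencil)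
    (W A : WeierstrassCurve ℚ) [W.IsElliptic] [W.IsGloballyMinimal] [A.IsElliptic] [A.IsGloballyMinimal]
    [Fact (Nat.Prime 5)] (hW : W = ⟨0, 0, 0, -519960, 151523264⟩) (hA : A = ⟨0, 0, 0, -30, 56⟩)
    (hPollack : ∀ {N : ℕ} [NeZero N] {f : CuspForm (Gamma0 N) 2},
      pollack_exists_plusMinusPAdicLFunction (W := A) (f := f) (p := 5))
    [NeZero (W.conductorNorm ℤ)] {f₀ : CuspForm (Gamma0 (W.conductorNorm ℤ)) 2} (hf₀ : IsNewformOf W f₀)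
    [NeZero (A.conductorNorm ℤ)] {f₀' : CuspForm (Gamma0 (A.conductorNorm ℤ)) 2} (hf₀' : IsNewformOf A f₀')
    {Θ Θ' : IwasawaAlgebra 5}
    (hΘ : iwasawaToPowerSeries 5 Θ = ((mazurTateElement f₀ 5 1).map (algebraMap ℚ ℚ_[5]) : PowerSeries ℚ_[5]))
    (hΘ0 : Θ ≠ 0) (hμ : mu Θ = 0) (hlam : lam Θ = (cyclotomicOmegaPlus 5 1).natDegree + 2)
    (hΘ' : iwasawaToPowerSeries 5 Θ' = ((mazurTateElement f₀' 5 1).map (algebraMap ℚ ℚ_[5]) : PowerSeries ℚ_[5]))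
    (hΘ'0 : Θ' ≠ 0) (hμ' : mu Θ' = 0) (hlam' : lam Θ' = (cyclotomicOmegaPlus 5 1).natDegree + 1) :
    ∃ ε : ℤˣ, KobayashiMainConjecture W 5 ε :=
  ⟨-1, lam4_kobayashiMainConjecture_301824bp1_5 h12 h41 h5 h3 h09 hKim hPR hmod hF W A hW hA hPollack hf₀ hf₀'
    (-1) hΘ0 hμ hΘ'0 hμ' (⟨rfl, hΘ, hlam, hΘ', hlam'⟩)⟩

/-- **`BSD(E,5)` for `301824bp1`** (X7, `r_an = 0`, `5Nn`; desk cell `residue; [(5,'X7')]` (OPEN)) **through the IMAGE-FREE rank-0 road**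
`bsdp_of_kobayashiMainConjecture_of_analyticRank_eq_zero` (Kobayashi Thm. 1.2 `h12`, B. D. Kim 2013 Cor. 3.15 `hKim13`, Pollack `hPollackW`,
modularity `hmod`/`hmod'`, GZK `hGZK`) fed with `lam4_kobayashiMainConjecture_301824bp1_5` (`ε = -1` rows); the rank datum `hr : r_an = 0` (Cremona)
is displayed; class X7 decided in the kernel (good supersingular at `5`, additive at `2`). NO descent certificate, NO `BSDp` input, NO preprint.
PER PAIR; nothing booked; BSD is not proved by any of this.
[cite: Kobayashi2003, Thm. 1.2 and Conjecture (p. 2)] [cite: BDKim2013, Cor. 3.15 (p. 199)] [cite: BDKim2009, Cor. 2.13 (p. 187)]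
[cite: Miller2011LMS, Def. 1.1] [cite: Cremona2006, Table 1 (Cremona label 301824bp1)] -/
theorem lam4_bsdp_301824bp1_5
    (h12 : Kobayashi2003.thm12_signedSelmerDual_finite_torsion)
    (h41 : Kobayashi2003.thm41_signedCharIdeal_divisibility)
    (h5 : realPeriodRat_eq_unit_mul_plusPeriod) (h3 : realPeriodRat_eq_unit_mul_plusPeriod_three)
    (h09 : cor213_signedMu_eq_zero_iff_of_torsionIso)
    (hKim : BDKim2009.cor213_signedLambda_add_sum_delta_eq_of_torsionIso)
    (hPR : PollackRubin2004.mainTheorem_signedCharIdeal_eq_of_cm)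
    (hmod : nonempty_modularParametrizationData)
    (hF : thm132_fiveCongruent_hessePencil) (hmod' : hasEntireLFunction_rat)
    (hKim13 : BDKim2013.cor315_signedCharValue_rankZero)
    (hGZK : rank_eq_analyticRank_of_analyticRank_le_one)
    (W A : WeierstrassCurve ℚ) [W.IsElliptic] [W.IsGloballyMinimal] [A.IsElliptic] [A.IsGloballyMinimal]
    [Fact (Nat.Prime 5)] (hW : W = ⟨0, 0, 0, -519960, 151523264⟩) (hA : A = ⟨0, 0, 0, -30, 56⟩)
    (hr : W.analyticRank = 0)
    (hPollack : ∀ {N : ℕ} [NeZero N] {f : CuspForm (Gamma0 N) 2},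
      pollack_exists_plusMinusPAdicLFunction (W := A) (f := f) (p := 5))
    (hPollackW : ∀ {N : ℕ} [NeZero N] {f : CuspForm (Gamma0 N) 2},
      pollack_exists_plusMinusPAdicLFunction (W := W) (f := f) (p := 5))
    [NeZero (W.conductorNorm ℤ)] {f₀ : CuspForm (Gamma0 (W.conductorNorm ℤ)) 2} (hf₀ : IsNewformOf W f₀)
    [NeZero (A.conductorNorm ℤ)] {f₀' : CuspForm (Gamma0 (A.conductorNorm ℤ)) 2} (hf₀' : IsNewformOf A f₀')
    {Θ Θ' : IwasawaAlgebra 5}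
    (hΘ : iwasawaToPowerSeries 5 Θ = ((mazurTateElement f₀ 5 1).map (algebraMap ℚ ℚ_[5]) : PowerSeries ℚ_[5]))
    (hΘ0 : Θ ≠ 0) (hμ : mu Θ = 0) (hlam : lam Θ = (cyclotomicOmegaPlus 5 1).natDegree + 2)
    (hΘ' : iwasawaToPowerSeries 5 Θ' = ((mazurTateElement f₀' 5 1).map (algebraMap ℚ ℚ_[5]) : PowerSeries ℚ_[5]))
    (hΘ'0 : Θ' ≠ 0) (hμ' : mu Θ' = 0) (hlam' : lam Θ' = (cyclotomicOmegaPlus 5 1).natDegree + 1) :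
    BSDp W 5 := by
  have hI : integralModelInt W = ⟨0, 0, 0, -519960, 151523264⟩ :=
    integralModelInt_eq_of_map_eq _ (by rw [hW]; ext <;> simp [WeierstrassCurve.map])
  have hp2 : (5 : ℕ) ≠ 2 := by decide
  have hX : ClassX7 W 5 :=
    classX7_of_intModel 5 hI (by decide) card_lam25_301824bp1_5 (by norm_num) 2 Nat.prime_two (by decide) (by decide)
  have hap : W.frobeniusTrace 5 = 0 := by rw [frobeniusTrace_eq hI card_lam25_301824bp1_5]; norm_num
  exact bsdp_of_kobayashiMainConjecture_of_analyticRank_eq_zero W 5 h12 hKim13 hPollackW hmod hmod' hGZK hp2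
    hX.1.1 hap (ClassX7.irr W 5 hp2 hX) hr
    (lam4_kobayashiMainConjecture_301824bp1_5 h12 h41 h5 h3 h09 hKim hPR hmod hF W A hW hA hPollack hf₀ hf₀' (-1)
      hΘ0 hμ hΘ'0 hμ' (⟨rfl, hΘ, hlam, hΘ', hlam'⟩))

end Summit.BirchSwinnertonDyer.BirchSwinnertonDyer.Theorems.SmallImageCongruenceRoad

end
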